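import Literature.AnabelianGeometry.SemiGraphs.PSCCompactifiedNodePackage
import Literature.AnabelianGeometry.SemiGraphs.PSCLevelwiseCofinal
import HarnessLib

/-!
# [CombGC] Thm. 1.6 (ii): level-wise group-theoretic edge-likeness of the induced isomorphisms of the
# COMPACTIFIED coverings below a sturdy level implies that `α` carries nodal classes to nodal classes —
# hence, with Thm. 1.6 (i), that `α` is group-theoretically edge-like (ONE-CALL entry point)

Mochizuki, *A combinatorial version of the Grothendieck conjecture*, Tohoku Math. J. **59** (2007) [CombGC],
proof of Theorem 1.6 (ii), author's ms p. 14 l.18–24 ("by replacing `G`, `H` by their respective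
compactifications … we may assume … noncuspidal … by Remark 1.4.4, the assumption that `α` is edge-wise
filtration-preserving implies that `α` is group-theoretically edge-like"), render `paper:url-6994f81053dc`
p0014. [cite: MochizukiCombGC2007, Thm 1.6(ii) p.14]

PROOF-ONLY file (abc-iut cell, layer L3, `plan/L3/SUBDAG-CombGC-Thm16.md` row T16-L09b, holder
abc-iut-w5-d188): the node analogue of `PSCUnrLevelwiseDescent.lean`, at the CANONICAL presentations
`Π_{G_U} ↠ Π_{G_U} ⧸ Ker(↠ Π^cpt)` (abc-iut-L3-t4's `compactify` of `restrictBD`).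
**`nodal_transport_of_levelwise_gtEdgeLike_compactify`**: for profinite `Π_G`, `Π_H`, `α : Π_G ≅ Π_H`, an open
normal `U₀ ≤ Π_G`: if at every open normal `U ≤ U₀` (`U' := α U`) the induced
`ᾱ_U : Π_{(G_U)'} ≅ Π_{(H_{U'})'}` over `α|_U` is GROUP-THEORETICALLY EDGE-LIKE between the compactified coverings
and Prop. 1.2 (i) holds for both compactified coverings (`EdgeLikeOpenInterDeterminesEdge`, BY NAME), then
`α` carries nodal classes to nodal classes and back; **`isGroupTheoreticallyEdgeLike_of_levelwise_gtEdgeLike_compactify`**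
adds "`α` group-theoretically cuspidal" (Thm. 1.6 (i)) to conclude that `α` is group-theoretically edge-like.
Composition of `node_package_of_gtEdgeLike` (p427499) with `nodal_transport_of_graphic_mod_le` (p427370);
finite index, compactness of `U`, normality of `α U`, Hausdorffness of the quotients and the kernels of the
canonical presentations are supplied here.  No definitions; nothing here takes a side on [IUTchIII] Cor. 3.12.
-/

noncomputable section

namespace Literature.AnabelianGeometry.SemiGraphs

namespace PSCDatum

open scoped Pointwise

universe u

variable {P : Type u} [Group P] [TopologicalSpace P]
variable {P' : Type u} [Group P'] [TopologicalSpace P']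
variable [IsTopologicalGroup P] [CompactSpace P] [TotallyDisconnectedSpace P]
variable [IsTopologicalGroup P'] [CompactSpace P'] [TotallyDisconnectedSpace P']

omit [TotallyDisconnectedSpace P] in
/-- An open subgroup of the compact `Π_G` has finite index. [cite: MochizukiCombGC2007, Def 1.1(ii) p.6] -/
private theorem finiteIndex_of_isOpen'' (U : Subgroup P) (hU : IsOpen (U : Set P)) : U.FiniteIndex := by
  haveI : DiscreteTopology (P ⧸ U) := QuotientGroup.discreteTopology_iff.mpr hU
  haveI : Finite (P ⧸ U) := finite_of_compact_of_discrete
  exact Subgroup.finiteIndex_of_finite_quotient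

omit [TotallyDisconnectedSpace P] in
/-- An open subgroup of the compact `Π_G` is compact. [cite: MochizukiCombGC2007, Def 1.1(ii) p.6] -/
private theorem compactSpace_of_isOpen'' (U : Subgroup P) (hU : IsOpen (U : Set P)) : CompactSpace U :=
  isCompact_iff_compactSpace.mp (Subgroup.isClosed_of_isOpen U hU).isCompact

variable (G : PSCDatum P) (H : PSCDatum P') (α : P ≃ₜ* P')

/-- **[CombGC] Thm. 1.6 (ii), compactification step composed with the node descent, ONE-CALL FORM.**
Let `Π_G`, `Π_H` be profinite, `α : Π_G ≅ Π_H`, `U₀ ≤ Π_G` open normal.  Suppose that for every open normal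
`U ≤ U₀` (finite index, compactness and the normality/finite index of `U' := α U` are supplied to the
hypothesis), there are branch data, an open-ness witness for `U'`, and — the compactified coverings
`(G.restrictBD U).compactify`, `(H.restrictBD U').compactify` being formed with the supplied normality of
`Ker(↠ Π^cpt)` — an isomorphism `αU : U ≅ U'` restricting `α` and an isomorphism `ᾱ_U` of the compactified
fundamental groups over `αU` which is GROUP-THEORETICALLY EDGE-LIKE, together with Prop. 1.2 (i) for both
compactified coverings.  Then `α` carries nodal classes to nodal classes and every nodal class of `Π_H`
arises. [cite: MochizukiCombGC2007, Thm 1.6(ii) p.14] -/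
theorem nodal_transport_of_levelwise_gtEdgeLike_compactify {U₀ : Subgroup P} (hU₀n : U₀.Normal)
    (hU₀o : IsOpen (U₀ : Set P))
    (h : ∀ (U : Subgroup P) [U.Normal] [U.FiniteIndex] [CompactSpace U] (hUo : IsOpen (U : Set P)), U ≤ U₀ →
      ∀ [(U.map α.toMulEquiv.toMonoidHom).Normal] [(U.map α.toMulEquiv.toMonoidHom).FiniteIndex]
        [CompactSpace (U.map α.toMulEquiv.toMonoidHom : Subgroup P')],
      ∃ (bd : G.BranchData) (bd' : H.BranchData)
        (hU'o : IsOpen ((U.map α.toMulEquiv.toMonoidHom : Subgroup P') : Set P')),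
      ∀ [(G.restrictBD U hUo bd).cptKer.Normal]
        [(H.restrictBD (U.map α.toMulEquiv.toMonoidHom) hU'o bd').cptKer.Normal],
      ∃ (αU : U ≃ₜ* (U.map α.toMulEquiv.toMonoidHom))
        (_ : ∀ u : U, ((αU u : (U.map α.toMulEquiv.toMonoidHom : Subgroup P')) : P') = α u)
        (ᾱ : (U ⧸ (G.restrictBD U hUo bd).cptKer) ≃ₜ*
          ((U.map α.toMulEquiv.toMonoidHom) ⧸ (H.restrictBD (U.map α.toMulEquiv.toMonoidHom) hU'o bd').cptKer))
        (_ : ∀ u : U, ᾱ (QuotientGroup.mk' (G.restrictBD U hUo bd).cptKer u) =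
          QuotientGroup.mk' (H.restrictBD (U.map α.toMulEquiv.toMonoidHom) hU'o bd').cptKer (αU u)),
        ((G.restrictBD U hUo bd).compactify).IsGroupTheoreticallyEdgeLike
            ((H.restrictBD (U.map α.toMulEquiv.toMonoidHom) hU'o bd').compactify) ᾱ ∧
          ((G.restrictBD U hUo bd).compactify).EdgeLikeOpenInterDeterminesEdge ∧
          ((H.restrictBD (U.map α.toMulEquiv.toMonoidHom) hU'o bd').compactify).EdgeLikeOpenInterDeterminesEdge) :
    (∀ A, G.IsNodal A → H.IsNodal (A.map α.toMulEquiv.toMonoidHom)) ∧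
      ∀ B, H.IsNodal B → ∃ A, G.IsNodal A ∧ A.map α.toMulEquiv.toMonoidHom = B := by
  refine nodal_transport_of_graphic_mod_le α G H hU₀n hU₀o fun U hUn hUo hle => ?_
  haveI := hUn
  haveI : U.FiniteIndex := finiteIndex_of_isOpen'' U hUo
  haveI : CompactSpace U := compactSpace_of_isOpen'' U hUo
  haveI : (U.map α.toMulEquiv.toMonoidHom).Normal := Subgroup.Normal.map hUn _ α.surjective
  have hU'o' : IsOpen ((U.map α.toMulEquiv.toMonoidHom : Subgroup P') : Set P') := by
    rw [Subgroup.coe_map]; exact α.isOpenMap _ hUo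
  haveI : (U.map α.toMulEquiv.toMonoidHom).FiniteIndex := finiteIndex_of_isOpen'' _ hU'o'
  haveI : CompactSpace (U.map α.toMulEquiv.toMonoidHom : Subgroup P') := compactSpace_of_isOpen'' _ hU'o'
  obtain ⟨bd, bd', hU'o, h⟩ := h U hUo hle
  haveI := (G.restrictBD U hUo bd).cptKer_normal
  haveI := (H.restrictBD (U.map α.toMulEquiv.toMonoidHom) hU'o bd').cptKer_normal
  haveI := (G.restrictBD U hUo bd).t2Space_quotient_cptKer
  haveI := (H.restrictBD (U.map α.toMulEquiv.toMonoidHom) hU'o bd').t2Space_quotient_cptKer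
  obtain ⟨αU, hαU, ᾱ, hᾱ, hge, hEG, hEH⟩ := h
  exact node_package_of_gtEdgeLike G H α U hUo bd (U.map α.toMulEquiv.toMonoidHom) hU'o bd'
    (QuotientGroup.mk' _) QuotientGroup.continuous_mk (QuotientGroup.mk'_surjective _)
    (QuotientGroup.mk' _) QuotientGroup.continuous_mk (QuotientGroup.mk'_surjective _) rfl αU hαU ᾱ hᾱ
    (QuotientGroup.ker_mk' _) (QuotientGroup.ker_mk' _) hge hEG hEH

/-- **With Thm. 1.6 (i) (`α` group-theoretically cuspidal): `α` is group-theoretically edge-like.**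
[cite: MochizukiCombGC2007, Thm 1.6(ii) p.14] -/
theorem isGroupTheoreticallyEdgeLike_of_levelwise_gtEdgeLike_compactify {U₀ : Subgroup P}
    (hU₀n : U₀.Normal) (hU₀o : IsOpen (U₀ : Set P)) (hc : G.IsGroupTheoreticallyCuspidal H α)
    (h : ∀ (U : Subgroup P) [U.Normal] [U.FiniteIndex] [CompactSpace U] (hUo : IsOpen (U : Set P)), U ≤ U₀ →
      ∀ [(U.map α.toMulEquiv.toMonoidHom).Normal] [(U.map α.toMulEquiv.toMonoidHom).FiniteIndex]
        [CompactSpace (U.map α.toMulEquiv.toMonoidHom : Subgroup P')],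
      ∃ (bd : G.BranchData) (bd' : H.BranchData)
        (hU'o : IsOpen ((U.map α.toMulEquiv.toMonoidHom : Subgroup P') : Set P')),
      ∀ [(G.restrictBD U hUo bd).cptKer.Normal]
        [(H.restrictBD (U.map α.toMulEquiv.toMonoidHom) hU'o bd').cptKer.Normal],
      ∃ (αU : U ≃ₜ* (U.map α.toMulEquiv.toMonoidHom))
        (_ : ∀ u : U, ((αU u : (U.map α.toMulEquiv.toMonoidHom : Subgroup P')) : P') = α u)
        (ᾱ : (U ⧸ (G.restrictBD U hUo bd).cptKer) ≃ₜ*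
          ((U.map α.toMulEquiv.toMonoidHom) ⧸ (H.restrictBD (U.map α.toMulEquiv.toMonoidHom) hU'o bd').cptKer))
        (_ : ∀ u : U, ᾱ (QuotientGroup.mk' (G.restrictBD U hUo bd).cptKer u) =
          QuotientGroup.mk' (H.restrictBD (U.map α.toMulEquiv.toMonoidHom) hU'o bd').cptKer (αU u)),
        ((G.restrictBD U hUo bd).compactify).IsGroupTheoreticallyEdgeLike
            ((H.restrictBD (U.map α.toMulEquiv.toMonoidHom) hU'o bd').compactify) ᾱ ∧
          ((G.restrictBD U hUo bd).compactify).EdgeLikeOpenInterDeterminesEdge ∧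
          ((H.restrictBD (U.map α.toMulEquiv.toMonoidHom) hU'o bd').compactify).EdgeLikeOpenInterDeterminesEdge) :
    G.IsGroupTheoreticallyEdgeLike H α := by
  obtain ⟨h₁, h₂⟩ := nodal_transport_of_levelwise_gtEdgeLike_compactify G H α hU₀n hU₀o h
  exact isGroupTheoreticallyEdgeLike_of_nodal_of_cuspidal h₁ h₂ hc

end PSCDatum

end Literature.AnabelianGeometry.SemiGraphs
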